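import Summits.Langlands.Langlands.Theorems.HalfIntegralTwistCM.Negative.ModulusParallel
import HarnessLib

/-!
# `UnitaryMirror` at `n = 1` — a certified base case of the lever of line `unitary-mirror-parity`
(crux `RegularTwistCM`, stmt-Langlands-14069; negative lane, `--supports`: a small-model fact about a
stub of line `unitary-mirror-parity`, landed by the cycle-3 disprover so that the lead may import it)

For EVERY automorphic Borel–Jacquet datum `π` on `GL₁(𝔸_K)` (any number field) with archimedean parameter
`P`, there is one real `c` with `P(ῑ) = {-z̄ + c : z ∈ P(ι)}` at every embedding `ι`. The proof is exactly
the two tree theorems the cycle-3 Disproof (§6, F11/F13) says it is: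
* the PAIRING `p - q ∈ ℤ` at a complex place (`archParam_embedding_sub_conj_mem_int_glOne`, sibling
  Negative lane of `HalfIntegralTwistCM`) — this alone gives the mirror embedding by embedding
  (`mirror_glOne_iff`: the `n = 1` mirror is `Im p = Im q`);
* Weil's PARALLELISM of real parts (`exists_re_archParam_parallel_glOne`, `|θ| = ‖·‖^σ`) — this, and only
  this, makes the constant `c = 2σ` UNIFORM in `ι`.
So `UnitaryMirror` restricted to `n = 1` holds for all (not only cuspidal) `GL₁` data; the content of the
stub is in `n ≥ 2` (unitarity of cuspidal `π_w` up to twist) and in the uniformity of `c`, which the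
composition `RegularTwistCM_of` of the line never uses (Disproof F13).
-/

set_option linter.dupNamespace false

open scoped Classical ComplexConjugate
open NumberField NumberField.InfinitePlace

namespace Summit.Langlands.Langlands.Theorems.RegularTwistCM.Negative

open Literature.NumberTheory.Automorphic
open Summit.Langlands.Langlands.Theorems.HalfIntegralTwistCM.Negative

variable {K : Type} [Field K] [NumberField K] {hcpt : isCompact_glFiniteIntegralLevel 1 K}

/-- The pointwise identity behind the `n = 1` mirror: `Re(p + q) = 2σ` and `Im p = Im q` give
`-p̄ + 2σ = q`. [folklore] -/
theorem neg_conj_add_two_sigma {p q : ℂ} {σ : ℝ} (hre : (p + q).re = 2 * σ) (him : p.im = q.im) :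
    -conj p + ((2 * σ : ℝ) : ℂ) = q := by
  rw [Complex.add_re] at hre
  apply Complex.ext
  · simp
    linarith
  · simp [him]

/-- **`UnitaryMirror` for `GL₁` (all automorphic data, any number field).** [folklore] -/
theorem unitaryMirror_glOne (π : AutomorphicRepData (AutomorphyDatum.gl 1 K hcpt))
    {P : (K →+* ℂ) → Multiset ℂ} (hP : π.HasArchParameter P) :
    ∃ c : ℝ, ∀ ι : K →+* ℂ,
      P (ComplexEmbedding.conjugate ι) = (P ι).map (fun z => -conj z + (c : ℂ)) := by
  obtain ⟨σ, hreal, hcomplex⟩ := exists_re_archParam_parallel_glOne π hP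
  refine ⟨2 * σ, fun ι => ?_⟩
  rcases (InfinitePlace.mk ι).isReal_or_isComplex with hr | hc
  · -- real place: `ῑ = ι = σ_w`, `P ι = {a}` with `Re a = σ`
    have hι : ComplexEmbedding.IsReal ι := isReal_mk_iff.mp hr
    have hconj : ComplexEmbedding.conjugate ι = ι := ComplexEmbedding.isReal_iff.mp hι
    have hemb : (InfinitePlace.mk ι).embedding = ι := embedding_mk_eq_of_isReal hι
    obtain ⟨θ, hθ⟩ := π.exists_heckeCharacter_glOne
    obtain ⟨a, ha, -⟩ := archParam_realPlace_glOne π hθ hP ⟨InfinitePlace.mk ι, hr⟩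
    have hre : a.re = σ := hreal ⟨InfinitePlace.mk ι, hr⟩ a ha
    rw [hemb] at ha
    rw [hconj, ha, Multiset.map_singleton, Multiset.singleton_inj]
    exact (neg_conj_add_two_sigma (p := a) (q := a) (σ := σ)
      (by rw [Complex.add_re]; linarith) rfl).symm
  · -- complex place `w = mk ι`: `P σ_w = {p}`, `P σ̄_w = {q}`, `p - q ∈ ℤ`, `Re(p + q) = 2σ`
    obtain ⟨p, q, m, hp, hq, hm⟩ :=
      archParam_embedding_sub_conj_mem_int_glOne π hP ⟨InfinitePlace.mk ι, hc⟩
    have hpq : (p + q).re = 2 * σ := hcomplex ⟨InfinitePlace.mk ι, hc⟩ p q hp hq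
    have him : p.im = q.im := by
      have := congrArg Complex.im hm
      simp at this
      linarith
    rcases mk_eq_iff.mp (mk_embedding (InfinitePlace.mk ι)) with h1 | h1
    · -- `ι = σ_w`
      rw [← h1, hq, hp, Multiset.map_singleton, Multiset.singleton_inj]
      exact (neg_conj_add_two_sigma hpq him).symm
    · -- `ι = σ̄_w`, `ῑ = σ_w`
      have h2 : ComplexEmbedding.conjugate ι = (InfinitePlace.mk ι).embedding := by
        have e : ComplexEmbedding.conjugate (ComplexEmbedding.conjugate (InfinitePlace.mk ι).embedding) =
            (InfinitePlace.mk ι).embedding := star_star _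
        rw [h1] at e
        exact e
      rw [h1] at hq
      rw [h2, hp, hq, Multiset.map_singleton, Multiset.singleton_inj]
      exact (neg_conj_add_two_sigma (by rw [add_comm]; exact hpq) him.symm).symm

/-- Hence the lever `UnitaryMirror` of `Lines/unitary-mirror-parity.lean`, restricted to `n = 1`, verbatim
(cuspidal data are automorphic data). [folklore] -/
theorem unitaryMirror_one :
    ∀ (K : Type) [Field K] [NumberField K] (hcpt : isCompact_glFiniteIntegralLevel 1 K)
      (π : CuspidalAutomorphicRepData 1 K hcpt) (P : (K →+* ℂ) → Multiset ℂ), π.1.HasArchParameter P →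
        ∃ c : ℝ, ∀ ι : K →+* ℂ,
          P (ComplexEmbedding.conjugate ι) = (P ι).map (fun z => -conj z + (c : ℂ)) :=
  fun _K _ _ _hcpt π _P hP => unitaryMirror_glOne π.1 hP

end Summit.Langlands.Langlands.Theorems.RegularTwistCM.Negative
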